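import Literature.Geometry.Lorentzian.KerrDataProofs
import Literature.Geometry.Lorentzian.KerrWaveEnergy
import HarnessLib

/-!
# The late pieces `{t* > c}` of the Kerr–Schild chart domains are connected

`{x ∈ Kerr.region a r₀ | c < x⁰}` is the image of `(c, ∞) × Kerr.slice a r₀` under
`(t, y) ↦ (t, y)` (the Kerr–Schild radius does not depend on `t*`; `Kerr.isConnected_slice_holds`),
hence connected — the preconnectedness hypothesis on late pieces of the ω-limit existence theorem
`Spacetime.exists_omegaLimit_timeTranslates_of_lateChart` (`FutureChartOmegaLimit.lean`) for the
eternal far zone `Kerr.region 0 R` and, more generally, for every ingoing Kerr–Schild chart domain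
(their invariance under time translations is `Kerr.add_smul_basisVector_zero_mem_region`,
`KerrStationaryBlackHole.lean`; `Kerr.radius_ofTimeSpace` is in `KerrWaveEnergy.lean`).

## References
* B. O'Neill, *The geometry of Kerr black holes*, A K Peters 1995, Ch. 2, §2.1. [ONeill1995]
* M. Dafermos, I. Rodnianski, arXiv:0811.0354, §5.1. [arXiv08110354]
-/

noncomputable section

open Set Filter Topology

namespace Literature.Geometry.Lorentzian.Kerr

/-- **The late pieces of the chart domains are connected**: for every `c`,
`{x ∈ Kerr.region a r₀ | c < x⁰}` is connected (image of `(c, ∞) × Kerr.slice a r₀`).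
[cite: ONeill1995, Ch. 2 §2.1] -/
theorem isConnected_latePiece_region (a r₀ c : ℝ) :
    IsConnected {x : E4 | x ∈ (region a r₀ : Set E4) ∧ c < x 0} := by
  have hcont : Continuous fun p : ℝ × E3 ↦ E4.ofTimeSpace p.1 p.2 := by
    refine (PiLp.continuous_toLp 2 _).comp ?_
    refine continuous_pi fun i ↦ ?_
    refine Fin.cases ?_ (fun j ↦ ?_) i
    · simpa using continuous_fst
    · simpa [Function.comp_def] using (PiLp.continuous_apply 2 _ j).comp continuous_snd
  have heq : {x : E4 | x ∈ (region a r₀ : Set E4) ∧ c < x 0} =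
      (fun p : ℝ × E3 ↦ E4.ofTimeSpace p.1 p.2) '' (Ioi c ×ˢ (slice a r₀ : Set E3)) := by
    ext x
    simp only [SetLike.mem_coe, mem_region, mem_image, mem_prod, mem_Ioi, mem_setOf_eq, Prod.exists]
    constructor
    · rintro ⟨hx, hc⟩
      refine ⟨E4.time x, E4.spatial x, ⟨hc, ?_⟩, E4.ofTimeSpace_time_spatial x⟩
      change max r₀ 0 < radius a (E4.ofTimeSpace 0 (E4.spatial x))
      rw [← radius_ofTimeSpace a (E4.time x), E4.ofTimeSpace_time_spatial]
      exact hx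
    · rintro ⟨t, y, ⟨ht, hy⟩, rfl⟩
      refine ⟨?_, by simpa using ht⟩
      rw [radius_ofTimeSpace]
      exact hy
  rw [heq]
  exact ((isConnected_Ioi).prod (isConnected_slice_holds a r₀)).image _ hcont.continuousOn

/-- Preconnected form. [cite: ONeill1995, Ch. 2 §2.1] -/
theorem isPreconnected_latePiece_region (a r₀ c : ℝ) :
    IsPreconnected {x : E4 | x ∈ (region a r₀ : Set E4) ∧ c < x 0} :=
  (isConnected_latePiece_region a r₀ c).isPreconnected

end Literature.Geometry.Lorentzian.Kerr

end
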